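import Summits.AtomisticToContinuum.Crystallization.Theorems.GappedShellCensusRadialDefectsVanishSplit

/-!
# SKELETON rev 3b — crux `GappedShellCensus.RadialDefectsVanish` (stmt-AtomisticToContinuum-15930), line `Sketch`
# (lead c2, 2026-08-17): the SPLIT composition

Line `Sketch` rev 2 (spine B, radial torus rigidity) is complete modulo its crux-sized core `stub_rdvTorusRigidity`
(transfer `radialDefectsVanish_of_torusRigidity` landed, p134542).  Rev 3 RESHAPES that one core stub (L4: "reshaped into
2–3 registered stubs at the skeleton level") into the route's SPLIT (gen 1) of the crux — strategist D5, glue kernel-checked in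
`Cruxes/RadialDefectsVanish/SplitGlue.lean` and LANDED by this seat as `Theorems/GappedShellCensusRadialDefectsVanishSplit.lean`
(p136458, ACCEPTED 2026-08-17: `RadialDefectsVanish_of_subs`, `RdvSplit.stub_thickThirteen_of_tammes`, `radialDefectsVanish_of_tammes`),
imported here (rev 3a carried the glue inline):

* `stub_twelveWithinOne`  — VERBATIM the hub item stmt-AtomisticToContinuum-15808 `SquareWellLayerCake.TwelveWithinOne`
  (= split child `GappedShellCensus.TwelveWithinOne`): ENERGY, open-problem grade, NOT this line's to prove (own crux chain).
* `stub_gapBeyondTwelve`  — VERBATIM the split child `GappedShellCensus.GapBeyondTwelve` (new crux; k-centre tolerant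
  Fejes Tóth/Hales geometry or energy): NOT this line's to prove (own crux chain once the ledger registers it).
* `stub_tammesThirteen`   — the Literature NAMED FACT `musinTarasov2012_tammes_thirteen` (Musin–Tarasov 2012, Thm 1; undischarged;
  tree programme `Literature/Geometry/DiscreteGeometry/SphericalCode*`): NOT this line's to prove.
* (CLOSED) `stub_thickThirteen_of_tammes` — named fact ⇒ split child `ThickThirteen` (projection lemma): LANDED p136458 as
  `RdvSplit.stub_thickThirteen_of_tammes` (--supports stmt-15930) together with the glue.

Composition: `RadialDefectsVanish_of := radialDefectsVanish_of_tammes stub_tammesThirteen stub_twelveWithinOne stub_gapBeyondTwelve`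
— the crux BY NAME, sorry-free modulo the three remaining `stub_*`, none of which is this line's to prove.
Terminal state of the line: blocked-on stmt-AtomisticToContinuum-15808 (∧ the GapBeyondTwelve child ∧ the Tammes-13 fact); standing
alternative closure: `RadialDefectsVanish_of_palmCruxes` (p135503) modulo stmt-9225 ∧ stmt-9226.
-/

noncomputable section

open scoped BigOperators Topology Classical RealInnerProductSpace
open Filter Finset
open Literature.MathematicalPhysics.StatisticalMechanics
open Literature.Geometry.DiscreteGeometry (musinTarasov2012_tammes_thirteen)

namespace Summit.AtomisticToContinuum.Crystallization.Theorems

/-! ## The registered stubs -/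

/-- STUB 1 (= hub item stmt-AtomisticToContinuum-15808 `SquareWellLayerCake.TwelveWithinOne`, verbatim; ENERGY, open-problem
grade; not this line's to prove). -/
theorem stub_twelveWithinOne : ∀ x : (N : ℕ) → (Fin N → EuclideanSpace ℝ (Fin 3)), (∀ N, Literature.MathematicalPhysics.StatisticalMechanics.IsGroundState Literature.MathematicalPhysics.StatisticalMechanics.lennardJones (x N)) → Filter.Tendsto (fun N : ℕ => (Nat.card {i : Fin N // ¬ ((∀ j : Fin N, dist (x N i) (x N j) ≤ 11 / 10 → ∀ k : Fin N, k ≠ j → (55 : ℝ) / 57 ≤ dist (x N j) (x N k)) ∧ 12 ≤ (Finset.univ.filter fun j : Fin N => j ≠ i ∧ dist (x N i) (x N j) ≤ 1).card)} : ℝ) / N) Filter.atTop (nhds 0) := by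
  sorry

/-- STUB 2 (= the Literature named fact `musinTarasov2012_tammes_thirteen`, Musin–Tarasov 2012 Thm 1; undischarged; not this
line's to prove). -/
theorem stub_tammesThirteen : musinTarasov2012_tammes_thirteen := by
  sorry

/-- STUB 3 (= split child `GappedShellCensus.GapBeyondTwelve`, verbatim; new crux — k-centre tolerant Fejes Tóth/Hales geometry or
energy; not this line's to prove). -/
theorem stub_gapBeyondTwelve : ∀ x : (N : ℕ) → (Fin N → EuclideanSpace ℝ (Fin 3)), (∀ N, Literature.MathematicalPhysics.StatisticalMechanics.IsGroundState Literature.MathematicalPhysics.StatisticalMechanics.lennardJones (x N)) → ∀ θ : ℝ, 0 < θ → ∃ᶠ N in Filter.atTop, (Nat.card {i : Fin N // (∀ j : Fin N, dist (x N i) (x N j) ≤ 7 / 2 → (∀ k : Fin N, dist (x N j) (x N k) ≤ 11 / 10 → ∀ l : Fin N, l ≠ k → (55 : ℝ) / 57 ≤ dist (x N k) (x N l)) ∧ (Finset.univ.filter fun k : Fin N => k ≠ j ∧ dist (x N j) (x N k) ≤ 1).card = 12) ∧ ∃ j : Fin N, j ≠ i ∧ 1 < dist (x N i) (x N j) ∧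 dist (x N i) (x N j) < 21 / 17} : ℝ) ≤ θ * N := by
  sorry

/-! ## Composition: the crux BY NAME, modulo the stubs -/

/-- **The crux from the three stubs** (an existing hub item, a Literature named fact, the split's new child) through the landed
`radialDefectsVanish_of_tammes` (p136458). -/
theorem RadialDefectsVanish_of :
    Summit.AtomisticToContinuum.Crystallization.Theses.GappedShellCensus.RadialDefectsVanish :=
  radialDefectsVanish_of_tammes stub_tammesThirteen stub_twelveWithinOne stub_gapBeyondTwelve

end Summit.AtomisticToContinuum.Crystallization.Theorems

end
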